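import Summits.CriticalPhenomena.PercolationContinuityZ3.Theorems.PercNearOneGluingNoHeavyLowerTailSahiCombZetaCozeta
import Summits.CriticalPhenomena.PercolationContinuityZ3.Theorems.PercNearOneGluingNoHeavyLowerTailSahiCombTriWCertificateClasses

/-!
# The Σ certificate has trivial kernel on the stratum `F_∅ = F_p`, `G_∅ = G_q` (a = 2) — a stratum beyond the pointwise/type-LP wall

Support file of the one-cut programme (crux `NoHeavyLowerTail`, stmt-CriticalPhenomena-4575; TRI lane of cell `prim-masterthm`; seat prim-lf-1 gen 26,
memo `FROM-prim-lf-1-gen26-PRINCIPAL-AND-NOGO.md` §5; the proof is the human transcription of prim-lf-1 gen 21's type-level engine run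
`code/gen21/abstract.py` restricted to this stratum, memo `FROM-prim-lf-1-gen21-CLOSURE.md` §0(iv)).

Setting: the two-copy certificate Σ of `…SahiCombTriWCertificate` (`certSigmaWeight`) at `a = 2`, `P = univ`, in the function language of
`…TriWCertificateClasses` / `…FiveUpSetRankZ3`, on the STRATUM where the `F`-family does not see the coordinate `p` at the bottom and the
`G`-family does not see `q` at the bottom: `F_∅ = F_p = A ⊆ F_q = B ⊆ F_⊤ = C` and `G_∅ = G_q = D ⊆ G_p = E ⊆ G_⊤ = H` (six up-sets, two chains).
Token classes (supports): `L_∅ ⊆ A ∩ refl H`, `L_p ⊆ A ∩ refl D`, `L_q ⊆ B ∩ refl E`, `L_⊤ ⊆ C ∩ refl D`; `R_∅ ⊆ refl A ∩ H`, `R_p ⊆ refl A ∩ D`,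
`R_q ⊆ refl B ∩ E`, `R_⊤ ⊆ refl C ∩ D`; `K_∅ ⊆ refl(A ∩ D)`, `K_p ⊆ refl(A ∩ E)`, `K_q ⊆ refl(B ∩ D)`, `K_⊤ ⊆ refl(C ∩ H)`; supply fibres
`U_∅ = A ∩ D`, `U_p = A ∩ E`, `U_q = B ∩ D`, `U_⊤ = C ∩ H`; local tags from `T4_∅ = refl(A ∩ H)`, `T4_p = refl(A ∩ D)`, `T4_q = refl(B ∩ E)`,
`T4_⊤ = refl(C ∩ D)`.

* **`FiveUpSet.sigma_kernel_eq_zero_stratum_FpGq`** — if twelve coefficient vectors with these supports satisfy the eight Σ fibre equations (copy 1: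
  `L_∅,L_⊤,R_∅,R_p,R_q,K_∅,K_⊤`; copy 2: `L_∅,L_p,L_q,R_p,R_q,R_⊤,K_p,K_q`, each class seen by the fibres `y ⊇ x`) and the four local tag equations,
  then all twelve vanish.
PROOF (eleven phases; Z = zeta sum `zsum`, Ĥ = co-zeta sum; tools: point support, C2′ `eq_zero_of_zsum_eq_zero_on`, (T1) and its dual and Möbius
peeling from `…SahiCombZetaCozeta`): (0) tags: `K_∅ = K_p = K_q = 0`, `K_⊤` lives on `refl(C∩H ∖ (A ∪ D ∪ B∩E))`; (1) `R_p = 0` (copy-1 fibres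
`p` minus `∅`, C2′ on `A∩D`); (2) `L_p = 0` (copy-2 fibres `p`, `∅`); (3) `Z R_q = 0` on `D` (Ĥ R_q = 0 on `refl D` by three cases, dual T1);
(4) `R_⊤ = 0` (copy-2 top and `q` fibres on `C∩D`); (5) `K_⊤ = 0` (hat forms of both top equations on the three live regions, peeling);
(6) `R_∅ = 0` (Ĥ R_∅ = 0 on `refl H` by three cases, dual T1, C2′); (7) `L_⊤ = 0`, (8) `L_q = 0`, (9) `R_q = 0`, (10) `L_∅ = 0` (C2′).
WHY IT MATTERS: P5 gen 15 showed that on this stratum `TRI_W(2) ≥ 0` has NO pointwise / type-LP certificate (value −1/16), so this is the first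
kernel theorem in the tree for an `a = 2` stratum beyond that wall; the counting bridge to `0 ≤ triW P F G` on the stratum (plumbing through
`certRow … certSigmaWeight` and `triW_nonneg_of_certRow_linearIndependent`) is NOT done here.
HONEST LABEL: a kernel theorem for one stratum; `CertSigmaKernelZero` and `TriWIneq` remain OPEN. [this work]
-/

namespace Summit.CriticalPhenomena.PercolationContinuityZ3.Theorems

namespace FiveUpSet

open Finset

variable {α : Type} [DecidableEq α] [Fintype α]

/-! ### Small tools: co-zeta support, peeling on the support, linearity -/

/-- Co-zeta support: if `f` lives on `{d | dᶜ ∈ Q}` (`Q` an up-set) and `sᶜ ∉ Q`, then `Σ_{d ⊇ s} f d = 0`. [this work] -/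
theorem cozsum_eq_zero_of_compl_not_mem {Q : Finset (Finset α)} (hQ : IsUpperSet (Q : Set (Finset α))) (f : Finset α → ℚ)
    (hf : ∀ d, f d ≠ 0 → dᶜ ∈ Q) {s : Finset α} (hs : sᶜ ∉ Q) :
    ∑ d, f d * (if s ⊆ d then (1 : ℚ) else 0) = 0 := by
  refine sum_eq_zero fun d _ => ?_
  by_cases hd : f d = 0
  · rw [hd, zero_mul]
  · have hsd : ¬ s ⊆ d := fun h => hs (hQ (compl_subset_compl.2 h) (hf d hd))
    rw [if_neg hsd, mul_zero]

/-- **Peeling on the support.**  If the co-zeta sum of `f` vanishes at every point of the support of `f`, then `f = 0`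
(look at a maximal element of the support). [this work] -/
theorem eq_zero_of_cozsum_eq_zero_on_support (f : Finset α → ℚ)
    (h : ∀ s, f s ≠ 0 → ∑ d, f d * (if s ⊆ d then (1 : ℚ) else 0) = 0) : ∀ s, f s = 0 := by
  suffices H : ∀ n : ℕ, ∀ s : Finset α, sᶜ.card = n → f s = 0 from fun s => H _ s rfl
  intro n
  induction n using Nat.strong_induction_on with
  | _ n ih =>
    intro s hs
    by_contra hne
    have habove : ∀ d, s ⊆ d → d ≠ s → f d = 0 := by
      intro d hsd hds
      have hlt : dᶜ.card < sᶜ.card := by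
        apply card_lt_card
        refine ⟨compl_subset_compl.2 hsd, fun hsub => hds ?_⟩
        have : d ⊆ s := by
          have := compl_subset_compl.1 hsub
          exact this
        exact Subset.antisymm this hsd
      exact ih _ (hs ▸ hlt) d rfl
    exact hne (eq_zero_of_cozsum_top f s (h s hne) habove)

/-- Linearity of the zeta sum. [this work] -/
theorem zsum_add (f g : Finset α → ℚ) (t : Finset α) : zsum (fun d => f d + g d) t = zsum f t + zsum g t := by
  unfold zsum
  rw [← sum_add_distrib]
  exact sum_congr rfl fun d _ => by ring

/-- Linearity of the co-zeta sum. [this work] -/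
theorem cozsum_add (f g : Finset α → ℚ) (s : Finset α) :
    ∑ d, (f d + g d) * (if s ⊆ d then (1 : ℚ) else 0)
      = ∑ d, f d * (if s ⊆ d then (1 : ℚ) else 0) + ∑ d, g d * (if s ⊆ d then (1 : ℚ) else 0) := by
  rw [← sum_add_distrib]
  exact sum_congr rfl fun d _ => by ring

/-- The co-zeta sum of the zero function vanishes. [this work] -/
theorem cozsum_eq_zero_of_forall_eq_zero (f : Finset α → ℚ) (hf : ∀ d, f d = 0) (s : Finset α) :
    ∑ d, f d * (if s ⊆ d then (1 : ℚ) else 0) = 0 :=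
  sum_eq_zero fun d _ => by rw [hf d, zero_mul]

/-! ### The stratum theorem -/

/-- **The Σ-kernel is trivial on the stratum `F_∅ = F_p`, `G_∅ = G_q`.**  Six up-sets `A ⊆ B ⊆ C` (`= F_∅ = F_p, F_q, F_⊤`) and `D ⊆ E ⊆ H`
(`= G_∅ = G_q, G_p, G_⊤`); twelve coefficient vectors with the supports of the classes `L_x, R_x, K_x` (`x = ∅, p, q, ⊤`); the eight Σ fibre
equations (`P = univ`) and the four local tag equations.  Then all coefficient vectors vanish. [this work] -/
theorem sigma_kernel_eq_zero_stratum_FpGq (A B C D E H : Finset (Finset α))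
    (hA : IsUpperSet (A : Set (Finset α))) (hB : IsUpperSet (B : Set (Finset α))) (hC : IsUpperSet (C : Set (Finset α)))
    (hD : IsUpperSet (D : Set (Finset α))) (hE : IsUpperSet (E : Set (Finset α))) (hH : IsUpperSet (H : Set (Finset α)))
    (hAB : A ⊆ B) (hBC : B ⊆ C) (hDE : D ⊆ E) (hEH : E ⊆ H)
    (l0 lp lq l1 r0 rp rq r1 k0 kp kq k1 : Finset α → ℚ)
    (sl0 : ∀ d, l0 d ≠ 0 → d ∈ A ∧ dᶜ ∈ H) (slp : ∀ d, lp d ≠ 0 → d ∈ A ∧ dᶜ ∈ D)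
    (slq : ∀ d, lq d ≠ 0 → d ∈ B ∧ dᶜ ∈ E) (sl1 : ∀ d, l1 d ≠ 0 → d ∈ C ∧ dᶜ ∈ D)
    (sr0 : ∀ d, r0 d ≠ 0 → dᶜ ∈ A ∧ d ∈ H) (srp : ∀ d, rp d ≠ 0 → dᶜ ∈ A ∧ d ∈ D)
    (srq : ∀ d, rq d ≠ 0 → dᶜ ∈ B ∧ d ∈ E) (sr1 : ∀ d, r1 d ≠ 0 → dᶜ ∈ C ∧ d ∈ D)
    (sk0 : ∀ d, k0 d ≠ 0 → dᶜ ∈ A ∧ dᶜ ∈ D) (skp : ∀ d, kp d ≠ 0 → dᶜ ∈ A ∧ dᶜ ∈ E)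
    (skq : ∀ d, kq d ≠ 0 → dᶜ ∈ B ∧ dᶜ ∈ D) (sk1 : ∀ d, k1 d ≠ 0 → dᶜ ∈ C ∧ dᶜ ∈ H)
    (e10 : ∀ t, t ∈ A → t ∈ D → zsum l0 t + zsum r0 t + zsum k0 t = 0)
    (e1p : ∀ t, t ∈ A → t ∈ E → zsum l0 t + zsum r0 t + zsum rp t + zsum k0 t = 0)
    (e1q : ∀ t, t ∈ B → t ∈ D → zsum l0 t + zsum r0 t + zsum rq t + zsum k0 t = 0)
    (e11 : ∀ t, t ∈ C → t ∈ H → zsum l0 t + zsum l1 t + zsum r0 t + zsum rp t + zsum rq t + zsum k0 t + zsum k1 t = 0)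
    (e20 : ∀ t, t ∈ A → t ∈ D → zsum l0 t = 0)
    (e2p : ∀ t, t ∈ A → t ∈ E → zsum l0 t + zsum lp t + zsum rp t + zsum kp t = 0)
    (e2q : ∀ t, t ∈ B → t ∈ D → zsum l0 t + zsum lq t + zsum rq t + zsum kq t = 0)
    (e21 : ∀ t, t ∈ C → t ∈ H → zsum l0 t + zsum lp t + zsum lq t + zsum rp t + zsum rq t + zsum r1 t + zsum kp t + zsum kq t = 0)
    (tg0 : ∀ e, eᶜ ∈ A → eᶜ ∈ H → k0 e + kp e + kq e + k1 e = 0)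
    (tgp : ∀ e, eᶜ ∈ A → eᶜ ∈ D → kp e + k1 e = 0)
    (tgq : ∀ e, eᶜ ∈ B → eᶜ ∈ E → kq e + k1 e = 0)
    (tg1 : ∀ e, eᶜ ∈ C → eᶜ ∈ D → k1 e = 0) :
    (∀ d, l0 d = 0) ∧ (∀ d, lp d = 0) ∧ (∀ d, lq d = 0) ∧ (∀ d, l1 d = 0) ∧
    (∀ d, r0 d = 0) ∧ (∀ d, rp d = 0) ∧ (∀ d, rq d = 0) ∧ (∀ d, r1 d = 0) ∧
    (∀ d, k0 d = 0) ∧ (∀ d, kp d = 0) ∧ (∀ d, kq d = 0) ∧ (∀ d, k1 d = 0) := by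
  have hAC : A ⊆ C := hAB.trans hBC
  have hDH : D ⊆ H := hDE.trans hEH
  -- ===== Phase 0: the tags kill K_∅, K_p, K_q and confine K_⊤ =====
  have hk1CD : ∀ e, eᶜ ∈ C → eᶜ ∈ D → k1 e = 0 := tg1
  have hk1BE : ∀ e, eᶜ ∈ B → eᶜ ∈ E → eᶜ ∉ D → k1 e = 0 := by
    intro e hB' hE' hD'
    have h := tgq e hB' hE'
    have hq : kq e = 0 := by
      by_contra hne
      exact hD' (skq e hne).2
    rw [hq, zero_add] at h
    exact h
  have hkq : ∀ d, kq d = 0 := by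
    intro e
    by_contra hne
    obtain ⟨hB', hD'⟩ := skq e hne
    have h := tgq e hB' (hDE hD')
    rw [hk1CD e (hBC hB') hD', add_zero] at h
    exact hne h
  have hkp : ∀ d, kp d = 0 := by
    intro e
    by_contra hne
    obtain ⟨hA', hE'⟩ := skp e hne
    by_cases hD' : eᶜ ∈ D
    · have h := tgp e hA' hD'
      rw [hk1CD e (hAC hA') hD', add_zero] at h
      exact hne h
    · have h := tg0 e hA' (hEH hE')
      have h0 : k0 e = 0 := by
        by_contra hne0
        exact hD' (sk0 e hne0).2
      rw [h0, hkq e, hk1BE e (hAB hA') hE' hD', zero_add, add_zero, add_zero] at h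
      exact hne h
  have hk0 : ∀ d, k0 d = 0 := by
    intro e
    by_contra hne
    obtain ⟨hA', hD'⟩ := sk0 e hne
    have h := tg0 e hA' (hDH hD')
    rw [hkp e, hkq e, hk1CD e (hAC hA') hD', add_zero, add_zero, add_zero] at h
    exact hne h
  -- live support of K_⊤: complement in C ∩ H, not in A, not in D, not in B ∩ E
  have sk1' : ∀ e, k1 e ≠ 0 → eᶜ ∈ C ∧ eᶜ ∈ H ∧ eᶜ ∉ A ∧ eᶜ ∉ D ∧ ¬ (eᶜ ∈ B ∧ eᶜ ∈ E) := by
    intro e hne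
    obtain ⟨hC', hH'⟩ := sk1 e hne
    have hD' : eᶜ ∉ D := fun h => hne (hk1CD e hC' h)
    have hBE' : ¬ (eᶜ ∈ B ∧ eᶜ ∈ E) := fun h => hne (hk1BE e h.1 h.2 hD')
    have hA' : eᶜ ∉ A := by
      intro hA'
      have h := tg0 e hA' hH'
      rw [hk0 e, hkp e, hkq e, zero_add, zero_add, zero_add] at h
      exact hne h
    exact ⟨hC', hH', hA', hD', hBE'⟩
  have zk0 : ∀ t, zsum k0 t = 0 := zsum_eq_zero_of_forall_eq_zero k0 hk0
  have zkp : ∀ t, zsum kp t = 0 := zsum_eq_zero_of_forall_eq_zero kp hkp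
  have zkq : ∀ t, zsum kq t = 0 := zsum_eq_zero_of_forall_eq_zero kq hkq
  -- point supports of the plain zeta sums
  have nl0 : ∀ t, t ∉ A → zsum l0 t = 0 := fun t ht => zsum_eq_zero_of_not_mem hA l0 (fun d hd => (sl0 d hd).1) ht
  have nlq : ∀ t, t ∉ B → zsum lq t = 0 := fun t ht => zsum_eq_zero_of_not_mem hB lq (fun d hd => (slq d hd).1) ht
  -- ===== Phase 1: R_p = 0 (copy-1 fibres p and ∅ on A ∩ D) =====
  have hrp : ∀ d, rp d = 0 := by
    refine eq_zero_of_zsum_eq_zero_on hD hA rp (fun d hd => ⟨(srp d hd).2, (srp d hd).1⟩) fun t htD htA => ?_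
    have h1 := e1p t htA (hDE htD)
    have h0 := e10 t htA htD
    linarith
  have zrp : ∀ t, zsum rp t = 0 := zsum_eq_zero_of_forall_eq_zero rp hrp
  -- ===== Phase 2: L_p = 0 (copy-2 fibres p and ∅ on A ∩ D) =====
  have hlp : ∀ d, lp d = 0 := by
    refine eq_zero_of_zsum_eq_zero_on hA hD lp slp fun t htA htD => ?_
    have h1 := e2p t htA (hDE htD)
    have h0 := e20 t htA htD
    rw [zrp t, zkp t] at h1
    linarith
  have zlp : ∀ t, zsum lp t = 0 := zsum_eq_zero_of_forall_eq_zero lp hlp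
  -- Z l0 = 0 on E (hence on D): copy-2 fibre p on A ∩ E, point support off A
  have zl0E : ∀ t, t ∈ E → zsum l0 t = 0 := by
    intro t htE
    by_cases htA : t ∈ A
    · have h := e2p t htA htE
      rw [zlp t, zrp t, zkp t] at h
      linarith
    · exact nl0 t htA
  -- hat consequences (T1)
  have hatl0E : ∀ s, sᶜ ∈ E → ∑ d, l0 d * (if s ⊆ d then (1 : ℚ) else 0) = 0 :=
    fun s hs => cozsum_eq_zero_of_zsum_eq_zero_on hE l0 zl0E hs
  have hatr0A : ∀ s, sᶜ ∉ A → ∑ d, r0 d * (if s ⊆ d then (1 : ℚ) else 0) = 0 :=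
    fun s hs => cozsum_eq_zero_of_compl_not_mem hA r0 (fun d hd => (sr0 d hd).1) hs
  have hatrqB : ∀ s, sᶜ ∉ B → ∑ d, rq d * (if s ⊆ d then (1 : ℚ) else 0) = 0 :=
    fun s hs => cozsum_eq_zero_of_compl_not_mem hB rq (fun d hd => (srq d hd).1) hs
  have hatl1D : ∀ s, sᶜ ∉ D → ∑ d, l1 d * (if s ⊆ d then (1 : ℚ) else 0) = 0 :=
    fun s hs => cozsum_eq_zero_of_compl_not_mem hD l1 (fun d hd => (sl1 d hd).2) hs
  have hatlqE : ∀ s, sᶜ ∉ E → ∑ d, lq d * (if s ⊆ d then (1 : ℚ) else 0) = 0 :=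
    fun s hs => cozsum_eq_zero_of_compl_not_mem hE lq (fun d hd => (slq d hd).2) hs
  -- hat forms of the copy-1 fibre equations ∅ (on A∩D) and q (on B∩D)
  have hBD : IsUpperSet ((B ∩ D : Finset (Finset α)) : Set (Finset α)) := isUpperSet_inter hB hD
  have hADu : IsUpperSet ((A ∩ D : Finset (Finset α)) : Set (Finset α)) := isUpperSet_inter hA hD
  have hAEu : IsUpperSet ((A ∩ E : Finset (Finset α)) : Set (Finset α)) := isUpperSet_inter hA hE
  have hCHu : IsUpperSet ((C ∩ H : Finset (Finset α)) : Set (Finset α)) := isUpperSet_inter hC hH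
  have hat10 : ∀ s, sᶜ ∈ A → sᶜ ∈ D →
      ∑ d, l0 d * (if s ⊆ d then (1 : ℚ) else 0) + ∑ d, r0 d * (if s ⊆ d then (1 : ℚ) else 0) = 0 := by
    intro s hsA hsD
    have h := cozsum_eq_zero_of_zsum_eq_zero_on hADu (fun d => l0 d + r0 d) (fun t ht => by
      rw [mem_inter] at ht
      have := e10 t ht.1 ht.2
      rw [zk0 t] at this
      rw [zsum_add]; linarith) (s := s) (mem_inter.2 ⟨hsA, hsD⟩)
    rwa [cozsum_add] at h
  have hat1q : ∀ s, sᶜ ∈ B → sᶜ ∈ D →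
      ∑ d, l0 d * (if s ⊆ d then (1 : ℚ) else 0) + ∑ d, r0 d * (if s ⊆ d then (1 : ℚ) else 0)
        + ∑ d, rq d * (if s ⊆ d then (1 : ℚ) else 0) = 0 := by
    intro s hsB hsD
    have h := cozsum_eq_zero_of_zsum_eq_zero_on hBD (fun d => (l0 d + r0 d) + rq d) (fun t ht => by
      rw [mem_inter] at ht
      have := e1q t ht.1 ht.2
      rw [zk0 t] at this
      rw [zsum_add, zsum_add]; linarith) (s := s) (mem_inter.2 ⟨hsB, hsD⟩)
    rwa [cozsum_add, cozsum_add] at h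
  -- ===== Phase 3: Ĥ R_q = 0 on refl D, hence Z R_q = 0 on D =====
  have hatrqD : ∀ s, sᶜ ∈ D → ∑ d, rq d * (if s ⊆ d then (1 : ℚ) else 0) = 0 := by
    intro s hsD
    by_cases hsB : sᶜ ∈ B
    · by_cases hsA : sᶜ ∈ A
      · have h1 := hat1q s hsB hsD
        have h0 := hat10 s hsA hsD
        linarith
      · have h1 := hat1q s hsB hsD
        rw [hatl0E s (hDE hsD), hatr0A s hsA] at h1
        linarith
    · exact hatrqB s hsB
  have zrqD : ∀ t, t ∈ D → zsum rq t = 0 := by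
    intro t htD
    have hrefl : IsLowerSet ((refl D : Finset (Finset α)) : Set (Finset α)) := isLowerSet_refl hD
    refine zsum_eq_zero_of_cozsum_eq_zero_on hrefl rq (fun s hs => hatrqD s (mem_refl.1 hs)) ?_
    rw [mem_refl, compl_compl]; exact htD
  -- ===== Phase 4: R_⊤ = 0 (copy-2 top and q fibres on C ∩ D) =====
  have hr1 : ∀ d, r1 d = 0 := by
    refine eq_zero_of_zsum_eq_zero_on hD hC r1 (fun d hd => ⟨(sr1 d hd).2, (sr1 d hd).1⟩) fun t htD htC => ?_
    have h1 := e21 t htC (hDH htD)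
    rw [zlp t, zrp t, zkp t, zkq t, zrqD t htD] at h1
    by_cases htB : t ∈ B
    · have hq := e2q t htB htD
      rw [zrqD t htD, zkq t] at hq
      linarith
    · rw [nl0 t (fun h => htB (hAB h)), nlq t htB] at h1
      linarith
  have zr1 : ∀ t, zsum r1 t = 0 := zsum_eq_zero_of_forall_eq_zero r1 hr1
  -- hat forms of the two top-fibre equations (on C ∩ H)
  have hat11 : ∀ s, sᶜ ∈ C → sᶜ ∈ H →
      ∑ d, l0 d * (if s ⊆ d then (1 : ℚ) else 0) + ∑ d, l1 d * (if s ⊆ d then (1 : ℚ) else 0)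
        + ∑ d, r0 d * (if s ⊆ d then (1 : ℚ) else 0) + ∑ d, rq d * (if s ⊆ d then (1 : ℚ) else 0)
        + ∑ d, k1 d * (if s ⊆ d then (1 : ℚ) else 0) = 0 := by
    intro s hsC hsH
    have h := cozsum_eq_zero_of_zsum_eq_zero_on hCHu (fun d => (((l0 d + l1 d) + r0 d) + rq d) + k1 d) (fun t ht => by
      rw [mem_inter] at ht
      have := e11 t ht.1 ht.2
      rw [zrp t, zk0 t] at this
      rw [zsum_add, zsum_add, zsum_add, zsum_add]; linarith) (s := s) (mem_inter.2 ⟨hsC, hsH⟩)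
    rwa [cozsum_add, cozsum_add, cozsum_add, cozsum_add] at h
  have hat21 : ∀ s, sᶜ ∈ C → sᶜ ∈ H →
      ∑ d, l0 d * (if s ⊆ d then (1 : ℚ) else 0) + ∑ d, lq d * (if s ⊆ d then (1 : ℚ) else 0)
        + ∑ d, rq d * (if s ⊆ d then (1 : ℚ) else 0) = 0 := by
    intro s hsC hsH
    have h := cozsum_eq_zero_of_zsum_eq_zero_on hCHu (fun d => (l0 d + lq d) + rq d) (fun t ht => by
      rw [mem_inter] at ht
      have := e21 t ht.1 ht.2
      rw [zlp t, zrp t, zr1 t, zkp t, zkq t] at this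
      rw [zsum_add, zsum_add]; linarith) (s := s) (mem_inter.2 ⟨hsC, hsH⟩)
    rwa [cozsum_add, cozsum_add] at h
  -- ===== Phase 5: K_⊤ = 0 (hat forms of both top equations on the live support, peeling) =====
  have hk1 : ∀ d, k1 d = 0 := by
    refine eq_zero_of_cozsum_eq_zero_on_support k1 fun s hne => ?_
    obtain ⟨hsC, hsH, hsA, hsD, hsBE⟩ := sk1' s hne
    have h1 := hat11 s hsC hsH
    have h2 := hat21 s hsC hsH
    rw [hatr0A s hsA, hatl1D s hsD] at h1
    by_cases hsB : sᶜ ∈ B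
    · -- then sᶜ ∉ E
      have hsE : sᶜ ∉ E := fun h => hsBE ⟨hsB, h⟩
      rw [hatlqE s hsE] at h2
      linarith
    · rw [hatrqB s hsB] at h1 h2
      by_cases hsE : sᶜ ∈ E
      · rw [hatl0E s hsE] at h1
        linarith
      · rw [hatlqE s hsE] at h2
        linarith
  have hatk1 : ∀ s, ∑ d, k1 d * (if s ⊆ d then (1 : ℚ) else 0) = 0 := cozsum_eq_zero_of_forall_eq_zero k1 hk1
  -- ===== Phase 6: R_∅ = 0 (Ĥ R_∅ = 0 on refl H; dual T1; C2′) =====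
  have hat1p : ∀ s, sᶜ ∈ A → sᶜ ∈ E →
      ∑ d, l0 d * (if s ⊆ d then (1 : ℚ) else 0) + ∑ d, r0 d * (if s ⊆ d then (1 : ℚ) else 0) = 0 := by
    intro s hsA hsE
    have h := cozsum_eq_zero_of_zsum_eq_zero_on hAEu (fun d => l0 d + r0 d) (fun t ht => by
      rw [mem_inter] at ht
      have := e1p t ht.1 ht.2
      rw [zrp t, zk0 t] at this
      rw [zsum_add]; linarith) (s := s) (mem_inter.2 ⟨hsA, hsE⟩)
    rwa [cozsum_add] at h
  have hatr0H : ∀ s, sᶜ ∈ H → ∑ d, r0 d * (if s ⊆ d then (1 : ℚ) else 0) = 0 := by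
    intro s hsH
    by_cases hsA : sᶜ ∈ A
    · by_cases hsE : sᶜ ∈ E
      · have h := hat1p s hsA hsE
        rw [hatl0E s hsE] at h
        linarith
      · have h1 := hat11 s (hAC hsA) hsH
        have h2 := hat21 s (hAC hsA) hsH
        have hsD : sᶜ ∉ D := fun h => hsE (hDE h)
        rw [hatl1D s hsD, hatk1 s] at h1
        rw [hatlqE s hsE] at h2
        linarith
    · exact hatr0A s hsA
  have hr0 : ∀ d, r0 d = 0 := by
    have zr0H : ∀ t, t ∈ H → zsum r0 t = 0 := by
      intro t htH
      refine zsum_eq_zero_of_cozsum_eq_zero_on (isLowerSet_refl hH) r0 (fun s hs => hatr0H s (mem_refl.1 hs)) ?_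
      rw [mem_refl, compl_compl]; exact htH
    exact eq_zero_of_zsum_eq_zero_on hH hA r0 (fun d hd => ⟨(sr0 d hd).2, (sr0 d hd).1⟩) fun t htH _ => zr0H t htH
  have zr0 : ∀ t, zsum r0 t = 0 := zsum_eq_zero_of_forall_eq_zero r0 hr0
  -- ===== Phase 7: L_⊤ = 0 (copy-1 top equation on C ∩ D, where Z L_∅ = Z R_q = 0) =====
  have hl1 : ∀ d, l1 d = 0 := by
    refine eq_zero_of_zsum_eq_zero_on hC hD l1 sl1 fun t htC htD => ?_
    have h1 := e11 t htC (hDH htD)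
    rw [zr0 t, zrp t, zk0 t, zsum_eq_zero_of_forall_eq_zero k1 hk1 t, zrqD t htD, zl0E t (hDE htD)] at h1
    linarith
  have zl1 : ∀ t, zsum l1 t = 0 := zsum_eq_zero_of_forall_eq_zero l1 hl1
  -- ===== Phase 8: L_q = 0 (top equations on B ∩ E ⊆ C ∩ H) =====
  have hlq : ∀ d, lq d = 0 := by
    refine eq_zero_of_zsum_eq_zero_on hB hE lq slq fun t htB htE => ?_
    have h1 := e11 t (hBC htB) (hEH htE)
    have h2 := e21 t (hBC htB) (hEH htE)
    rw [zl1 t, zr0 t, zrp t, zk0 t, zsum_eq_zero_of_forall_eq_zero k1 hk1 t] at h1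
    rw [zlp t, zrp t, zr1 t, zkp t, zkq t] at h2
    linarith
  have zlq : ∀ t, zsum lq t = 0 := zsum_eq_zero_of_forall_eq_zero lq hlq
  -- ===== Phase 9: R_q = 0 (copy-2 top equation on B ∩ E) =====
  have hrq : ∀ d, rq d = 0 := by
    refine eq_zero_of_zsum_eq_zero_on hE hB rq (fun d hd => ⟨(srq d hd).2, (srq d hd).1⟩) fun t htE htB => ?_
    have h2 := e21 t (hBC htB) (hEH htE)
    rw [zlp t, zlq t, zrp t, zr1 t, zkp t, zkq t, zl0E t htE] at h2
    linarith
  have zrq : ∀ t, zsum rq t = 0 := zsum_eq_zero_of_forall_eq_zero rq hrq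
  -- ===== Phase 10: L_∅ = 0 (copy-2 top equation on A ∩ H) =====
  have hl0 : ∀ d, l0 d = 0 := by
    refine eq_zero_of_zsum_eq_zero_on hA hH l0 sl0 fun t htA htH => ?_
    have h2 := e21 t (hAC htA) htH
    rw [zlp t, zlq t, zrp t, zrq t, zr1 t, zkp t, zkq t] at h2
    linarith
  exact ⟨hl0, hlp, hlq, hl1, hr0, hrp, hrq, hr1, hk0, hkp, hkq, hk1⟩

end FiveUpSet

end Summit.CriticalPhenomena.PercolationContinuityZ3.Theorems
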